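import Literature.NumberTheory.Automorphic.SerreConjectureProofs
import Literature.NumberTheory.GaloisRepresentations.SerreWeightBoundsProofs
import HarnessLib

/-!
# `ResidualBianchiDoorMod2` (item stmt-Langlands-13459, route ParityBlindBianchi): Serre's conjecture
# at `p = 2` — the newform of an irreducible `ρ̄ : Γ_ℚ → GL₂(k)`, `char k = 2`, has weight `2` or `4`

The item's residual input is "`ρ̄₂ ≅ ρ̄_f` for a newform `f` of weight `≥ 2`" for the mod-`2` reduction
`ρ̄₂` of an icosahedral Artin representation.  Here we read it off the tree's named fact
`Literature.NumberTheory.Automorphic.khare_wintenberger 2 k` (Khare–Wintenberger 2009, Thm. 9.1 with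
Kisin 2009 = Serre's conjecture in the strong form (3.2.4), `SerreModularityConjecture 2 k`), taken as a
hypothesis:

* `isOdd_of_charP_two` — at `p = 2` oddness is automatic (`det ρ̄(c)² = 1` and `-1 = 1`);
* `isSerreWeight_two_cases` — Serre's recipe at residue cardinality `q = 2` only produces the weights
  `2` and `4` (level two: `(a, b) = (0, 1)`; tame level one: `(0, 0) ↦ q`; wild: `α = 0`, `β = 1`,
  peu ramifiée `↦ 2`, très ramifiée `↦ 4`), so `k(ρ̄)` is EVEN — this is what makes the base change of
  the weight-`k(ρ̄)` newform C-algebraic (cohomological) with no half-integral twist;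
* `exists_newform_of_khare_wintenberger_two` — for `k` algebraically closed of characteristic `2`
  (discrete) and `ρ̄ : Γ_ℚ → GL₂(k)` irreducible: a level `N` prime to `2`, a weight `w ∈ {2, 4}`, a
  newform `f ∈ S_w(Γ₁(N))` and `ι_f : 𝓞_f →+* k` with `IsGaloisRepOfNewform1Int f ι_f {q ∣ 2N} ρ̄`
  (local restriction datum and residue embedding from `SerreConjectureProofs`).

References: C. Khare, J.-P. Wintenberger, Invent. Math. 178 (2009), Thm. 1.2, Thm. 9.1; M. Kisin,
Invent. Math. 178 (2009), Thm. 0.1; J.-P. Serre, Duke Math. J. 54 (1987), §2.6 ("pour `p = 2`, on a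
`k = 2` … ou `k = 4`"), (3.2.4).
-/

noncomputable section

set_option linter.dupNamespace false -- `Summit.Langlands.Langlands` is the mandated namespace (D-0017)

open scoped MatrixGroups Valued
open Field ValuativeRel CongruenceSubgroup Literature.NumberTheory.GaloisRepresentations
  Literature.NumberTheory.Automorphic Literature.NumberTheory.EllipticCurves.ModularForms
  Literature.NumberTheory.GaloisRepresentations.ModPGaloisRep
  Literature.NumberTheory.GaloisRepresentations.IsNonarchimedeanLocalField

namespace Summit.Langlands.Langlands.Theorems.ResidualBianchiDoorMod2

universe v

/-! ### Oddness is automatic in characteristic `2` -/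

/-- **At `p = 2` every `ρ̄ : Γ_ℚ → GL_n(k)` is odd**: for a complex conjugation `c`, `c² = 1`
(`IsComplexConjugation.sq_eq_one`), so `det ρ̄(c)` is a square root of `1` in the field `k`, i.e.
`±1 = 1 = -1` in characteristic `2`.  (Khare–Wintenberger's `S`-type condition is vacuous at `2`.)
[folklore] -/
theorem isOdd_of_charP_two {k : Type*} [Field k] [TopologicalSpace k] [CharP k 2] {n : ℕ}
    (σ : FramedGaloisRep ℚ k n) : σ.IsOdd := by
  intro φ c hc
  have hsq : ((Matrix.GeneralLinearGroup.det (σ c) : kˣ) : k) *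
      ((Matrix.GeneralLinearGroup.det (σ c) : kˣ) : k) = 1 := by
    rw [← Units.val_mul, ← map_mul, ← map_mul, ← sq, hc.sq_eq_one, map_one, map_one, Units.val_one]
  rcases mul_self_eq_one_iff.mp hsq with h | h
  · exact Units.ext (by rw [h, Units.val_neg, Units.val_one, CharTwo.neg_eq])
  · exact Units.ext (by rw [h, Units.val_neg, Units.val_one])

/-! ### Serre's recipe at `q = 2` gives weight `2` or `4` -/

section Weight

variable {F : Type} [Field F] [ValuativeRel F] [TopologicalSpace F] [IsNonarchimedeanLocalField F]
  {k : Type v} [Field k] [TopologicalSpace k]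

/-- **Serre weights at residue cardinality `2` are `2` or `4`.**  If `q = #𝓀_F = 2` then every Serre
weight of `ρ̄_F : Γ_F → GL₂(k)` (`ModPGaloisRep.IsSerreWeight`) is `2` or `4`: in the level-two case the
normalised exponents are `(a, b) = (0, 1)` and `m = 1 + 2·0 + 1 = 2`; in the tame level-one case
`(a, b) = (0, 0)` and `m = q = 2`; in the wild case `α = 0`, `β = 1 = α + 1`, so `m = 4` (très
ramifiée) or `m = 1 + 0 + 1 = 2`.  Serre 1987, §2.6. [folklore] -/
theorem isSerreWeight_two_cases (ρ : ModPGaloisRep F k 2)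
    (ι : absIntegers 𝒪[F] F ⧸ absMaximalIdeal F →+* k) (hq : residueFieldCard F = 2) {m : ℕ}
    (h : ρ.IsSerreWeight ι m) : m = 2 ∨ m = 4 := by
  classical
  rcases h with ⟨a, b, hab, hb, -, rfl⟩ | ⟨-, a, b, hab, hb, -, rfl⟩ | ⟨-, α, β, hα, hβ1, hβ, -, rfl⟩
  · left
    rw [hq] at hb ⊢
    omega
  · left
    rw [hq] at hb ⊢
    have ha0 : a = 0 := by omega
    have hb0 : b = 0 := by omega
    simp [ha0, hb0]
  · rw [hq] at hα hβ ⊢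
    have hα0 : α = 0 := by omega
    have hβ0 : β = 1 := by omega
    subst hα0 hβ0
    by_cases ht : ρ.IsTresRamifie
    · right; simp [ht]
    · left; simp [ht]

end Weight

/-! ### The newform of an irreducible `ρ̄` in characteristic `2` -/

/-- **Khare–Wintenberger at `p = 2`, as consumed by the item.**  Granted the named fact
`khare_wintenberger 2 k` (Serre's conjecture, strong form) for an algebraically closed field `k` of
characteristic `2` with the discrete topology: every continuous **irreducible** `ρ̄ : Γ_ℚ → GL₂(k)`
(oddness being automatic, `isOdd_of_charP_two`) arises from a newform `f ∈ S_w(Γ₁(N))` with `2 ∤ N`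
(`N = N(ρ̄)`, `ModPGaloisRep.not_dvd_serreLevel`) and **`w = 2` or `w = 4`** (`w = k(ρ̄)`,
`isSerreWeight_two_cases` with `ModPGaloisRep.isSerreWeight_serreWeight_holds`): there is
`ι_f : 𝓞_f →+* k` with `IsGaloisRepOfNewform1Int f ι_f {q ∣ N·2} ρ̄` (unramified at `q ∤ 2N` with
`charpoly ρ̄(Frob_q) = ι_f(X² - a_q X + ε(q) q^{w-1})`).  Khare–Wintenberger 2009, Thm. 9.1 (with
Kisin 2009); Serre 1987, §2.6, (3.2.4). [cite: KhareWintenberger2009, Thm. 1.2 and Thm. 9.1] -/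
theorem exists_newform_of_khare_wintenberger_two {k : Type v} [Field k] [TopologicalSpace k]
    [DiscreteTopology k] [CharP k 2] [IsAlgClosed k]
    (hKW : khare_wintenberger 2 k) (ρ : ModPGaloisRep ℚ k 2) (hirr : ρ.toGaloisRep.IsIrreducible) :
    ∃ (N : ℕ) (_ : NeZero N) (w : ℕ) (f : CuspForm (Gamma1 N) (w : ℤ))
      (ιf : coeffCharIntegers f →+* k),
      ¬ 2 ∣ N ∧ (w = 2 ∨ w = 4) ∧ IsNewform1 f ∧ IsGaloisRepOfNewform1Int f ιf {q | q ∣ N * 2} ρ := by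
  haveI : Fact (Nat.Prime 2) := ⟨Nat.prime_two⟩
  obtain ⟨loc⟩ := nonempty_localRestrictionAt 2 ρ
  obtain ⟨ι⟩ := nonempty_ringHom_residue (k := k) 2 loc.F loc.residueFieldCard_eq
  obtain ⟨f, ιf, hf, hρ⟩ := hKW ρ hirr (isOdd_of_charP_two ρ) loc ι
  refine ⟨serreLevel 2 ρ, ⟨fun h => not_dvd_serreLevel 2 ρ (h ▸ dvd_zero 2)⟩, serreWeight 2 ρ loc ι,
    f, ιf, not_dvd_serreLevel 2 ρ, ?_, hf, hρ⟩
  have hw := ModPGaloisRep.isSerreWeight_serreWeight_holds 2 ρ loc ι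
  have hq : residueFieldCard loc.F = 2 := loc.residueFieldCard_eq
  exact isSerreWeight_two_cases loc.rep ι hq hw

end Summit.Langlands.Langlands.Theorems.ResidualBianchiDoorMod2

end
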